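/-
Copyright (c) 2026. Released under Apache 2.0 license as described in the file LICENSE.
-/
import Summits.RiemannHypothesis.RiemannHypothesis.Theorems.LiDirichletTrendDefs
import Literature.NumberTheory.LFunctions.Xiao2020.KeiperLiTaylor
import HarnessLib

/-!
# KERNEL LINEAGE K-χ — soundness III (part 1): the finite form of the archimedean trend `lb_χ(n)`

RH-FREE, GRH-FREE.  bears_on: LADDER-RH L-D (Dirichlet rows).  WHAT THIS IS NOT: nothing here bears on the
truth of RH or GRH — the trend is the Li functional of the Gamma factor alone.

* `charLiTrend_eq_finite_sum` — the EXACT finite form of PART F's trend (Voros 2006 §4 for `ζ`, tree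
  `KeiperLiTrend.keiperLiCoeff_sub_osc_eq_finite_sum`): for every character `χ mod q` of parity `a` and `n ≥ 1`,
  `lb_χ(n) = n·t₁ + Σ_{j=2}^{n} (−1)^j C(n,j) w_j(a) ζ(j)`, `t₁ = ½log q − ½log π + ½ψ((1+a)/2)`
  (`ψ(½) = −γ − 2log 2`, `ψ(1) = −γ`), `w_j(0) = 1 − 2^{−j}`, `w_j(1) = 2^{−j}` — Li's change of variables for
  the Gamma factor (as in `Theorems/LiDirichletSplit.lean`), Leibniz at `s = 1`, and the polygamma series
  `hasSum_iteratedDeriv_digamma_half` at `1` (even) / `2` (odd);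
Part 2 (`Theorems/LiDirichletKernelTrend.lean`): the program `trendRows` encloses `j ↦ lb_χ(1+j)`.
-/

set_option linter.dupNamespace false

namespace Summit.RiemannHypothesis.RiemannHypothesis.Theorems.LiDirichletKernel

open Literature.NumberTheory.LFunctions Literature.NumberTheory.LFunctions.Xiao2020
open Literature.Analysis.SpecialFunctions.Complex
open Summit.RiemannHypothesis.RiemannHypothesis.Theorems.LiTheory
open Finset Complex Filter Topology
open scoped Nat

/-! ## The Gamma factor at `s = 1` (after `Theorems/LiDirichletSplit.lean`, whose lemmas are private) -/

section Analytic

variable {q : ℕ} (χ : DirichletCharacter ℂ q)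

/-- A point of the open right half-plane is not a pole `−m` of `Γ`. -/
private theorem ne_neg_nat_of_re_pos₃ {s : ℂ} (hs : 0 < s.re) (m : ℕ) : s ≠ -(m : ℂ) := by
  intro h
  have := congrArg Complex.re h
  simp at this
  linarith [(Nat.cast_nonneg m : (0 : ℝ) ≤ m)]

/-- The parity is `0` or `1`. -/
private theorem charParity_eq_zero_or_one : charParity χ = 0 ∨ charParity χ = 1 := by
  have := charParity_le_one χ; omega

/-- `Γ((1+a)/2)` is a positive real, hence in the slit plane. -/
private theorem Gamma_half_mem_slitPlane :
    Complex.Gamma ((1 + (charParity χ : ℂ)) / 2) ∈ slitPlane := by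
  have h : ((1 + (charParity χ : ℂ)) / 2) = (((1 + (charParity χ : ℝ)) / 2 : ℝ) : ℂ) := by push_cast; ring
  rw [h, Complex.Gamma_ofReal, mem_slitPlane_iff]
  left
  rw [Complex.ofReal_re]
  exact Real.Gamma_pos_of_pos (by positivity)

/-- Near `s = 1`: `d/ds [(c/2)s + log Γ((s+a)/2)] = c/2 + ½ψ((s+a)/2)`. -/
private theorem hasDerivAt_arch_eventually (c : ℂ) :
    ∀ᶠ s in 𝓝 (1 : ℂ), HasDerivAt (fun s ↦ c / 2 * s + Complex.log (Complex.Gamma ((s + (charParity χ : ℂ)) / 2)))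
      (c / 2 + Complex.digamma ((s + (charParity χ : ℂ)) / 2) / 2) s := by
  have hw : ContinuousAt (fun s : ℂ ↦ (s + (charParity χ : ℂ)) / 2) 1 := by fun_prop
  have hre1 : (0 : ℝ) < (((1 : ℂ) + (charParity χ : ℂ)) / 2).re := by simp; positivity
  have hre : ∀ᶠ s in 𝓝 (1 : ℂ), 0 < ((s + (charParity χ : ℂ)) / 2).re :=
    hw.eventually ((isOpen_lt continuous_const Complex.continuous_re).mem_nhds hre1)
  have hΓc : ContinuousAt (fun s : ℂ ↦ Complex.Gamma ((s + (charParity χ : ℂ)) / 2)) 1 := by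
    refine ContinuousAt.comp (g := Complex.Gamma) ?_ hw
    exact (Complex.differentiableAt_Gamma _ (fun m ↦ ne_neg_nat_of_re_pos₃ hre1 m)).continuousAt
  have hsl : ∀ᶠ s in 𝓝 (1 : ℂ), Complex.Gamma ((s + (charParity χ : ℂ)) / 2) ∈ slitPlane :=
    hΓc.eventually (isOpen_slitPlane.mem_nhds (Gamma_half_mem_slitPlane χ))
  filter_upwards [hre, hsl] with s hs hsl'
  have hpole : ∀ m : ℕ, (s + (charParity χ : ℂ)) / 2 ≠ -m := fun m ↦ ne_neg_nat_of_re_pos₃ hs m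
  have hΓd : HasDerivAt Complex.Gamma (deriv Complex.Gamma ((s + (charParity χ : ℂ)) / 2))
      ((s + (charParity χ : ℂ)) / 2) := (Complex.differentiableAt_Gamma _ hpole).hasDerivAt
  have hlin : HasDerivAt (fun s : ℂ ↦ (s + (charParity χ : ℂ)) / 2) (1 / 2) s := by
    simpa using ((hasDerivAt_id s).add_const (charParity χ : ℂ)).div_const 2
  have hcomp := (hΓd.comp s hlin).clog hsl'
  have hl : HasDerivAt (fun s : ℂ ↦ c / 2 * s) (c / 2) s := by simpa using (hasDerivAt_id s).const_mul (c / 2)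
  refine (hl.add hcomp).congr_deriv ?_
  simp only [Function.comp_apply, Complex.digamma_def, logDeriv_apply]
  field_simp

/-- `G_χ` is analytic at `1`. -/
private theorem analyticAt_arch (c : ℂ) :
    AnalyticAt ℂ (fun s ↦ c / 2 * s + Complex.log (Complex.Gamma ((s + (charParity χ : ℂ)) / 2))) 1 := by
  have hd : ∀ᶠ s in 𝓝 (1 : ℂ), DifferentiableAt ℂ
      (fun s ↦ c / 2 * s + Complex.log (Complex.Gamma ((s + (charParity χ : ℂ)) / 2))) s :=
    (hasDerivAt_arch_eventually χ c).mono fun s hs ↦ hs.differentiableAt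
  obtain ⟨U, hU, hUo, h1U⟩ := _root_.eventually_nhds_iff.1 hd
  exact DifferentiableOn.analyticAt (s := U) (fun s hs ↦ (hU s hs).differentiableWithinAt) (hUo.mem_nhds h1U)

/-- `G_χ^{(j+1)}(1) = (c/2 + ½ψ((·+a)/2))^{(j)}(1)`. -/
private theorem iteratedDeriv_succ_arch (c : ℂ) (j : ℕ) :
    iteratedDeriv (j + 1) (fun s ↦ c / 2 * s + Complex.log (Complex.Gamma ((s + (charParity χ : ℂ)) / 2))) 1 =
      iteratedDeriv j (fun s ↦ c / 2 + Complex.digamma ((s + (charParity χ : ℂ)) / 2) / 2) 1 := by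
  rw [iteratedDeriv_succ']
  refine Filter.EventuallyEq.iteratedDeriv_eq j ?_
  filter_upwards [hasDerivAt_arch_eventually χ c] with s hs
  exact hs.deriv

/-- Li's change of variables for the Gamma factor: `d^{m+1}/ds^{m+1}[s^m G_χ(s)]_{s=1} = 𝒜_χ^{(m)}(0)`. -/
private theorem iteratedDeriv_pow_mul_arch (m : ℕ) :
    iteratedDeriv (m + 1) (fun s ↦ s ^ m *
      ((Real.log ((q : ℝ) / Real.pi) : ℂ) / 2 * s + Complex.log (Complex.Gamma ((s + (charParity χ : ℂ)) / 2)))) 1 =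
      iteratedDeriv m (charTrendGen χ) 0 := by
  set c : ℂ := (Real.log ((q : ℝ) / Real.pi) : ℂ) with hc
  have hG := analyticAt_arch χ c
  have h := iteratedDeriv_pow_mul_eq_iteratedDeriv_comp_liMap (m + 1) hG
  simp only [Nat.add_sub_cancel] at h
  rw [h, iteratedDeriv_succ']
  refine Filter.EventuallyEq.iteratedDeriv_eq m ?_
  have hcont : ContinuousAt liMap 0 := (analyticAt_liMap zero_ne_one).continuousAt
  have hGd := hasDerivAt_arch_eventually χ c
  rw [← liMap_zero] at hGd
  filter_upwards [hcont.eventually hGd, eventually_ne_nhds (zero_ne_one : (0 : ℂ) ≠ 1)] with z hz hz1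
  rw [(hz.comp z (hasDerivAt_liMap hz1)).deriv, charTrendGen, hc]

/-! ## The polygamma values at `1/2` and `1` -/

/-- `Σ_m (m+1)^{−k} = ζ(k)` for `k ≥ 2`. -/
theorem hasSum_inv_succ_pow {k : ℕ} (hk : 2 ≤ k) :
    HasSum (fun m : ℕ ↦ (((m : ℂ) + 1) ^ k)⁻¹) (riemannZeta k) := by
  have hk1 : 1 < k := hk
  set f : ℕ → ℂ := fun n ↦ 1 / (n : ℂ) ^ k with hf
  have hsumR : Summable (fun n : ℕ ↦ 1 / (n : ℝ) ^ k) := Real.summable_one_div_nat_pow.2 hk1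
  have hsum : Summable f := by
    have := (Complex.ofRealCLM.summable hsumR)
    refine this.congr fun n ↦ ?_
    simp [f]
  have hζ : HasSum f (riemannZeta k) := by
    rw [zeta_nat_eq_tsum_of_gt_one hk1]
    exact hsum.hasSum
  have h := (hasSum_nat_add_iff' 1).2 hζ
  have h0 : ∑ i ∈ range 1, f i = 0 := by simp [f, zero_pow (by omega : k ≠ 0)]
  rw [h0, sub_zero] at h
  refine h.congr_fun fun m ↦ ?_
  simp only [f]
  push_cast
  rw [one_div]

/-- `dʲ/dsʲ [½ψ((s+a)/2)]_{s=1} = (−1)^{j+1} j! w_{j+1}(a) ζ(j+1)` for `j ≥ 1`, with `w_k(0) = 1 − 2^{−k}`,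
`w_k(1) = 2^{−k}`. -/
theorem iteratedDeriv_digamma_half_parity {j : ℕ} (hj : 1 ≤ j) :
    iteratedDeriv j (fun s ↦ Complex.digamma ((s + (charParity χ : ℂ)) / 2) / 2) 1 =
      (-1) ^ (j + 1) * (j ! : ℂ) *
        ((if charParity χ = 0 then (1 - 1 / 2 ^ (j + 1)) else 1 / 2 ^ (j + 1)) * riemannZeta ((j + 1 : ℕ) : ℂ)) := by
  rcases charParity_eq_zero_or_one χ with ha | ha
  · -- even: `ψ(s/2)/2` at `s = 1`
    rw [ha, if_pos rfl]
    have hfun : (fun s : ℂ ↦ Complex.digamma ((s + ((0 : ℕ) : ℂ)) / 2) / 2) = fun s ↦ Complex.digamma (s / 2) / 2 := by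
      funext s; simp
    rw [hfun]
    have hS := (hasSum_iteratedDeriv_digamma_half (s := 1) (by simp) hj).tsum_eq
    have hO := (Xiao2020.hasSum_inv_odd_pow (k := j + 1) (by omega)).tsum_eq
    rw [← hS, tsum_mul_left, hO]
  · -- odd: `ψ((s+1)/2)/2` at `s = 1` is `ψ(z/2)/2` at `z = 2`
    rw [ha, if_neg one_ne_zero]
    have hfun : (fun s : ℂ ↦ Complex.digamma ((s + ((1 : ℕ) : ℂ)) / 2) / 2) =
        fun s ↦ (fun z ↦ Complex.digamma (z / 2) / 2) (s + 1) := by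
      funext s; simp
    rw [hfun, iteratedDeriv_comp_add_const j (fun z ↦ Complex.digamma (z / 2) / 2) 1]
    simp only
    rw [show (1 : ℂ) + 1 = 2 by norm_num]
    have hS := (hasSum_iteratedDeriv_digamma_half (s := 2) (by simp) hj).tsum_eq
    rw [← hS, tsum_mul_left]
    congr 1
    have h2 : ∀ m : ℕ, (((2 : ℂ) + 2 * (m : ℂ)) ^ (j + 1))⁻¹ = 1 / 2 ^ (j + 1) * (((m : ℂ) + 1) ^ (j + 1))⁻¹ := by
      intro m
      rw [show (2 : ℂ) + 2 * (m : ℂ) = 2 * ((m : ℂ) + 1) by ring, mul_pow, mul_inv, one_div]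
    simp_rw [h2]
    rw [tsum_mul_left, (hasSum_inv_succ_pow (k := j + 1) (by omega)).tsum_eq]

end Analytic

/-! ## The finite form of the trend -/

/-- `t₁(q,a) = ½log q − ½log π − γ/2 − [a = 0]·log 2 = ½log(q/π) + ½ Re ψ((1+a)/2)`. -/
noncomputable def trendT1 (q a : ℕ) : ℝ :=
  Real.log q / 2 - Real.log Real.pi / 2 - Real.eulerMascheroniConstant / 2 - if a = 0 then Real.log 2 else 0

/-- The weights `w_j(0) = 1 − 2^{−j}`, `w_j(1) = 2^{−j}`. -/
noncomputable def trendW (a j : ℕ) : ℝ := if a = 0 then 1 - 1 / 2 ^ j else 1 / 2 ^ j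

/-- **RH-FREE. The finite form of the archimedean trend** (Dirichlet twin of Voros's formula,
`KeiperLiTrend.keiperLiCoeff_sub_osc_eq_finite_sum`): for every character `χ mod q` (`q ≥ 1`) and `n ≥ 1`,
`lb_χ(n) = n·t₁ + Σ_{j=2}^{n} (−1)^j C(n,j) w_j(a) ζ(j)`. -/
theorem charLiTrend_eq_finite_sum {q : ℕ} (hq : 0 < q) (χ : DirichletCharacter ℂ q) {n : ℕ} (hn : 1 ≤ n) :
    charLiTrend χ n = n * trendT1 q (charParity χ) +
      ∑ j ∈ Icc 2 n, (-1) ^ j * (n.choose j : ℝ) * trendW (charParity χ) j * (riemannZeta j).re := by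
  set c : ℂ := (Real.log ((q : ℝ) / Real.pi) : ℂ) with hc
  set G : ℂ → ℂ := fun s ↦ c / 2 * s + Complex.log (Complex.Gamma ((s + (charParity χ : ℂ)) / 2)) with hG
  have hGa : AnalyticAt ℂ G 1 := analyticAt_arch χ c
  obtain ⟨m, rfl⟩ : ∃ m, n = m + 1 := ⟨n - 1, by omega⟩
  -- `lb = Re (d^{m+1}[s^m G]/m!)`
  have h1 : charLiTrend χ (m + 1) = (iteratedDeriv (m + 1) (fun s ↦ s ^ m * G s) 1 / (m ! : ℂ)).re := by
    rw [charLiTrend, Nat.add_sub_cancel, ← iteratedDeriv_pow_mul_arch χ m]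
  rw [h1, show (fun s ↦ s ^ m * G s) = (fun s ↦ s ^ (m + 1 - 1) * G s) by simp,
    iteratedDeriv_pow_mul_one_eq_sum (by omega) hGa.contDiffAt, Nat.add_sub_cancel, sum_div]
  have hf : (m ! : ℂ) ≠ 0 := by exact_mod_cast Nat.factorial_ne_zero _
  -- the terms
  have hterm : ∀ j ∈ range (m + 1), ((m + 1).choose (j + 1) : ℂ) * ((m ! : ℂ) / (j ! : ℂ)) *
      iteratedDeriv (j + 1) G 1 / (m ! : ℂ) =
      ((m + 1).choose (j + 1) : ℂ) * (if j = 0 then c / 2 + Complex.digamma ((1 + (charParity χ : ℂ)) / 2) / 2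
        else (-1) ^ (j + 1) * ((if charParity χ = 0 then (1 - 1 / 2 ^ (j + 1)) else 1 / 2 ^ (j + 1)) *
          riemannZeta ((j + 1 : ℕ) : ℂ))) := by
    intro j _
    have hj : (j ! : ℂ) ≠ 0 := by exact_mod_cast Nat.factorial_ne_zero _
    rw [hG, iteratedDeriv_succ_arch χ c j]
    rcases eq_or_ne j 0 with hj0 | hj0
    · subst hj0
      simp only [if_true, iteratedDeriv_zero, Nat.factorial_zero, Nat.cast_one, div_one]
      field_simp
    · rw [if_neg hj0, iteratedDeriv_const_add (Nat.one_le_iff_ne_zero.2 hj0),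
        iteratedDeriv_digamma_half_parity χ (Nat.one_le_iff_ne_zero.2 hj0)]
      generalize (if charParity χ = 0 then (1 - 1 / 2 ^ (j + 1) : ℂ) else 1 / 2 ^ (j + 1)) = W
      field_simp
  rw [sum_congr rfl hterm, sum_range_succ']
  simp only [if_true, Nat.add_one_ne_zero, if_false, zero_add, Nat.choose_one_right]
  -- the `j = 0` term is `n·t₁`
  have hT : (((m + 1 : ℕ) : ℂ) * (c / 2 + Complex.digamma ((1 + (charParity χ : ℂ)) / 2) / 2)).re =
      ((m + 1 : ℕ) : ℝ) * trendT1 q (charParity χ) := by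
    have hqr : (0 : ℝ) < q := by exact_mod_cast hq
    have hlog2 : Complex.log 2 = ((Real.log 2 : ℝ) : ℂ) := by
      rw [show (2 : ℂ) = ((2 : ℝ) : ℂ) by norm_num, ← Complex.ofReal_log (by norm_num)]
    rcases charParity_eq_zero_or_one χ with ha | ha
    · rw [ha, trendT1, if_pos rfl, Nat.cast_zero, add_zero, Complex.digamma_one_half, hlog2, hc,
        Real.log_div hqr.ne' Real.pi_pos.ne']
      simp only [Complex.mul_re, Complex.natCast_re, Complex.natCast_im, zero_mul, sub_zero, Complex.add_re,
        Complex.div_ofNat_re, Complex.ofReal_re, Complex.sub_re, Complex.neg_re, Complex.re_ofNat,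
        Complex.ofReal_im, mul_zero]
      ring
    · rw [ha, trendT1, if_neg one_ne_zero, Nat.cast_one, show ((1 : ℂ) + 1) / 2 = 1 by norm_num,
        Complex.digamma_one, hc, Real.log_div hqr.ne' Real.pi_pos.ne']
      simp only [Complex.mul_re, Complex.natCast_re, Complex.natCast_im, zero_mul, sub_zero, Complex.add_re,
        Complex.div_ofNat_re, Complex.ofReal_re, Complex.neg_re]
      ring
  rw [Complex.add_re, hT]
  -- reindex the remaining sum to `Icc 2 (m+1)`
  have hre : ∑ j ∈ Icc 2 (m + 1), (-1 : ℝ) ^ j * ((m + 1).choose j : ℝ) * trendW (charParity χ) j *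
      (riemannZeta j).re = (∑ k ∈ range m, ((m + 1).choose (k + 1 + 1) : ℂ) *
        ((-1) ^ (k + 1 + 1) * ((if charParity χ = 0 then (1 - 1 / 2 ^ (k + 1 + 1)) else 1 / 2 ^ (k + 1 + 1)) *
          riemannZeta ((k + 1 + 1 : ℕ) : ℂ)))).re := by
    rw [← Finset.Ico_add_one_right_eq_Icc, sum_Ico_eq_sum_range, show m + 1 + 1 - 2 = m by omega, Complex.re_sum]
    refine sum_congr rfl fun k _ ↦ ?_
    rw [show 2 + k = k + 1 + 1 by omega]
    have : ((m + 1).choose (k + 1 + 1) : ℂ) * ((-1) ^ (k + 1 + 1) *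
        ((if charParity χ = 0 then (1 - 1 / 2 ^ (k + 1 + 1)) else 1 / 2 ^ (k + 1 + 1)) *
          riemannZeta ((k + 1 + 1 : ℕ) : ℂ))) =
        (((-1 : ℝ) ^ (k + 1 + 1) * ((m + 1).choose (k + 1 + 1) : ℝ) * trendW (charParity χ) (k + 1 + 1) : ℝ) : ℂ) *
          riemannZeta ((k + 1 + 1 : ℕ) : ℂ) := by
      unfold trendW
      split_ifs <;> push_cast <;> ring
    rw [this, Complex.re_ofReal_mul]
  rw [hre, add_comm]

end Summit.RiemannHypothesis.RiemannHypothesis.Theorems.LiDirichletKernel
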